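import Literature.NumberTheory.Automorphic.ArchWhittakerRieszVectors
import Literature.NumberTheory.Automorphic.ArchGroupGLUnimodular
import HarnessLib

/-!
# `G_∞`-covariance and cyclicity of the Riesz vectors of a continuous Whittaker functional

Topic `NumberTheory/Automorphic`; namespace `Literature.NumberTheory.Automorphic`.

Continuation of `ArchWhittakerRieszVectors` (Shalika (1974), §3, first steps of the archimedean
uniqueness argument for Whittaker functionals on unitary representations of `G_∞ = GL_n(K_∞)`):
for `τ` unitary strongly continuous on a Hilbert space `E`, `ℓ` a continuous `ψ_∞`-Whittaker
functional on its Gårding space and `ξ_α = whittakerRieszVector hcpt τ hτ ℓ α`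
(`⟪ξ_α, e⟫ = ℓ(τ(α) e)`), this file PROVES

* `IsArchTestFunction.comp_mul_right` — right translates `h ↦ α(h g)` of test functions are test
  functions (`α(x e^X g) = α((x g) e^{g⁻¹ X g})`, and `X ↦ g⁻¹ X g` is linear);
* `archSmoothing_apply_inv` — **`τ(α) τ(g)⁻¹ e = τ(α(· g)) e`**, by the UNIMODULARITY of `G_∞`
  (`isMulRightInvariant_of_isHaarMeasure_glInf`, `ArchGroupGLUnimodular`);
* `apply_whittakerRieszVector` — **`G_∞`-covariance `τ(g) ξ_α = ξ_{α(· g)}`** (unitarity: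
  `⟪τ(g) ξ, e⟫ = ⟪ξ, τ(g⁻¹) e⟫`);
* `topologicalClosure_span_whittakerRieszVector_eq_top` — **cyclicity**: for `τ` moreover
  topologically irreducible and `ℓ ≠ 0`, the Riesz vectors `ξ_α` span a DENSE subspace of `E`
  (its closure is a closed `τ`-stable subspace containing some `ξ_α ≠ 0`).

These are the covariance and density statements through which the intertwiner of
`IsArchContWhittakerFunctional.exists_eq_smul_of_intertwiner` (`ξ₁^α ↦ ξ₂^α`) is densely defined
and `τ`-equivariant; its existence as a bounded operator is the analytic heart of Shalika's proof
(quasi-invariant distributions) and is not addressed here. No definition, no named fact.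

## References

* J. A. Shalika, *The multiplicity one theorem for `GL_n`*, Ann. of Math. 100 (1974), §3
  [Shalika1974].
* J. R. Getz, H. Hahn, *An Introduction to Automorphic Representations*, GTM 300 (2024), §4.2,
  Lemma 4.2.1 [GetzHahn2024].
* A. W. Knapp, *Lie Groups Beyond an Introduction* (2002), Cor. 8.31 (unimodularity) [Knapp2002].
-/

noncomputable section

open MeasureTheory Measure NumberField NumberField.mixedEmbedding IsDedekindDomain Set Filter
open scoped MatrixGroups InnerProductSpace Topology Classical ContDiff Matrix.Norms.Operator
  ComplexConjugate

namespace Literature.NumberTheory.Automorphic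

variable {n : ℕ} {K : Type} [Field K] [NumberField K]

attribute [local instance] glInfBorel borelSpace_glInf locallyCompactSpace_glInf
  secondCountableTopology_glInf

-- Mathlib idiom (Mathlib/Algebra/Lie/OfAssociative.lean): the commutator Lie ring on matrices
attribute [local instance 100] LieRing.ofAssociativeRing

-- as in `ArchGardingWhittaker`: the scoped `L∞`-operator normed ring structure on matrices is only
-- reducibly defeq to the Pi uniformity
set_option backward.isDefEq.respectTransparency false

/-! ### 1. Right translates of test functions -/

section TestFunctions

/-- **Right translates of test functions are test functions**: `h ↦ α (h g)`. Continuity and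
compact support are clear; smoothness along `X ↦ x e^X` follows from
`x e^X g = (x g) e^{g⁻¹ X g}` (`Matrix.exp_units_conj'`) and the linearity of `X ↦ g⁻¹ X g`.
[folklore] -/
theorem IsArchTestFunction.comp_mul_right {α : GL (Fin n) (mixedSpace K) → ℂ}
    (hα : IsArchTestFunction n K α) (g : GL (Fin n) (mixedSpace K)) :
    IsArchTestFunction n K (fun h => α (h * g)) := by
  refine ⟨hα.1.comp (continuous_id.mul continuous_const), hα.2.comp_homeomorph (Homeomorph.mulRight g),
    fun x => ?_⟩
  -- the linear change of variable `X ↦ g⁻¹ X g` on `𝔤 = M_n(K_∞)`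
  have hmem : ∀ Y : Matrix (Fin n) (Fin n) (mixedSpace K), Y ∈ (archGroupGL n K).lie.toSubmodule :=
    fun Y => by
      change Y ∈ (archGroupGL n K).lie
      rw [archGroupGL_lie]
      exact LieSubalgebra.mem_top Y
  let L : (archGroupGL n K).lie.toSubmodule →ₗ[ℝ] (archGroupGL n K).lie.toSubmodule :=
    { toFun := fun X => ⟨((g⁻¹ : GL (Fin n) (mixedSpace K)) : Matrix (Fin n) (Fin n) (mixedSpace K)) *
          (X : Matrix (Fin n) (Fin n) (mixedSpace K)) * (g : Matrix (Fin n) (Fin n) (mixedSpace K)), hmem _⟩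
      map_add' := fun X Y => by
        ext : 1
        simp [mul_add, add_mul]
      map_smul' := fun t X => by
        ext : 1
        simp }
  have hL : ContDiff ℝ ∞ (fun X : (archGroupGL n K).lie.toSubmodule => L X) :=
    L.toContinuousLinearMap.contDiff
  -- `x e^X g = (x g) e^{g⁻¹ X g}` in `GL_n(K_∞)`
  have hexp : ∀ X : (archGroupGL n K).lie.toSubmodule,
      ((archGroupGL n K).expMem ⟨(L X : Matrix (Fin n) (Fin n) (mixedSpace K)), (L X).2⟩ :
        GL (Fin n) (mixedSpace K)) = g⁻¹ * expGL (X : Matrix (Fin n) (Fin n) (mixedSpace K)) * g := by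
    intro X
    refine Units.ext ?_
    rw [RealMatrixGroup.coe_expMem, coe_expGL, Units.val_mul, Units.val_mul, coe_expGL]
    exact Matrix.exp_units_conj' g _
  have key : (fun X : (archGroupGL n K).lie.toSubmodule =>
      α (x * (archGroupGL n K).carrier.subtype ((archGroupGL n K).expMem ⟨X, X.2⟩) * g)) =
      (fun X : (archGroupGL n K).lie.toSubmodule =>
        α (x * g * (archGroupGL n K).carrier.subtype ((archGroupGL n K).expMem ⟨X, X.2⟩))) ∘
        fun X => L X := by
    funext X
    simp only [Function.comp_apply, Subgroup.coe_subtype]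
    congr 1
    rw [hexp, RealMatrixGroup.coe_expMem]
    group
  show ContDiff ℝ ∞ (fun X : (archGroupGL n K).lie.toSubmodule =>
      α (x * (archGroupGL n K).carrier.subtype ((archGroupGL n K).expMem ⟨X, X.2⟩) * g))
  rw [key]
  exact (hα.3 (x * g)).comp hL

end TestFunctions

/-! ### 2. `τ(α) τ(g)⁻¹ = τ(α(· g))` (unimodularity) and the `G_∞`-covariance of `ξ_α` -/

section Covariance

variable {hcpt : isCompact_glFiniteIntegralLevel n K}
  {E : Type*} [NormedAddCommGroup E] [InnerProductSpace ℂ E] [CompleteSpace E]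
  {τ : ContRepresentation ℂ (AutomorphyDatum.gl n K hcpt).arch.carrier E}

variable (hcpt τ) in
omit [CompleteSpace E] in
/-- **`τ(α) τ(g⁻¹) e = τ(α(· g)) e`**: `∫ α(h) τ(h g⁻¹) e dh = ∫ α(h g) τ(h) e dh` by the right
invariance of the Haar measure of the unimodular group `G_∞ = GL_n(K_∞)`
(`isMulRightInvariant_of_isHaarMeasure_glInf`). [cite: Knapp2002, Cor. 8.31] -/
theorem archSmoothing_apply_inv (α : GL (Fin n) (mixedSpace K) → ℂ) (g : GL (Fin n) (mixedSpace K))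
    (e : E) :
    archSmoothing hcpt τ α (τ (toArch hcpt g⁻¹) e) = archSmoothing hcpt τ (fun h => α (h * g)) e := by
  haveI := isMulRightInvariant_of_isHaarMeasure_glInf n K (archHaar n K)
  unfold archSmoothing
  have hF : ∀ h : GL (Fin n) (mixedSpace K),
      α h • τ (toArch hcpt h) (τ (toArch hcpt g⁻¹) e) =
        (fun h' => α (h' * g) • τ (toArch hcpt h') e) (h * g⁻¹) := fun h => by
    simp only [inv_mul_cancel_right]
    change α h • (τ (toArch hcpt h) * τ (toArch hcpt g⁻¹)) e = _
    rw [← map_mul]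
    rfl
  simp_rw [hF]
  exact integral_mul_right_eq_self (fun h' => α (h' * g) • τ (toArch hcpt h') e) g⁻¹

variable {hτ : τ.IsStronglyContinuous} {ℓ : archGardingSpace hcpt τ →ₗ[ℂ] ℂ}

/-- Unitarity: `⟪τ(g) x, y⟫ = ⟪x, τ(g⁻¹) y⟫`. [folklore] -/
theorem inner_apply_left_eq_inner_apply_inv (hτu : τ.IsUnitary)
    (g : (AutomorphyDatum.gl n K hcpt).arch.carrier) (x y : E) :
    ⟪τ g x, y⟫_ℂ = ⟪x, τ g⁻¹ y⟫_ℂ := by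
  have h := hτu.inner_map_map g⁻¹ (τ g x) y
  have h2 : τ g⁻¹ (τ g x) = x := by
    change (τ g⁻¹ * τ g) x = x
    rw [← map_mul, inv_mul_cancel, map_one]
    rfl
  rw [h2] at h
  exact h.symm

/-- **`G_∞`-covariance of the Riesz vectors**: `τ(g) ξ_α = ξ_{α(· g)}` for `ℓ` a continuous
`ψ_∞`-Whittaker functional on the Gårding space of a unitary `τ` and `α` a test function
(`⟪τ(g) ξ_α, e⟫ = ⟪ξ_α, τ(g⁻¹) e⟫ = ℓ(τ(α) τ(g⁻¹) e) = ℓ(τ(α(· g)) e)`). [cite: Shalika1974, §3] -/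
theorem apply_whittakerRieszVector (hℓ : IsArchContWhittakerFunctional hcpt τ hτ ℓ) (hτu : τ.IsUnitary)
    {α : GL (Fin n) (mixedSpace K) → ℂ} (hα : IsArchTestFunction n K α) (g : GL (Fin n) (mixedSpace K)) :
    τ (toArch hcpt g) (whittakerRieszVector hcpt τ hτ ℓ α) =
      whittakerRieszVector hcpt τ hτ ℓ (fun h => α (h * g)) := by
  refine eq_whittakerRieszVector hℓ hτu (hα.comp_mul_right g) fun e => ?_
  rw [inner_apply_left_eq_inner_apply_inv hτu, inner_whittakerRieszVector hℓ hτu hα]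
  congr 1
  refine Subtype.ext ?_
  change archSmoothing hcpt τ α (τ (toArch hcpt g)⁻¹ e) = archSmoothing hcpt τ (fun h => α (h * g)) e
  rw [← archSmoothing_apply_inv hcpt τ α g e]
  rfl

/-- The span of the Riesz vectors `ξ_α`, `α` a test function, is `τ`-stable. [folklore] -/
theorem apply_mem_span_whittakerRieszVector (hℓ : IsArchContWhittakerFunctional hcpt τ hτ ℓ)
    (hτu : τ.IsUnitary) (g : (AutomorphyDatum.gl n K hcpt).arch.carrier) {v : E}
    (hv : v ∈ Submodule.span ℂ {ξ | ∃ α : GL (Fin n) (mixedSpace K) → ℂ, IsArchTestFunction n K α ∧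
      ξ = whittakerRieszVector hcpt τ hτ ℓ α}) :
    τ g v ∈ Submodule.span ℂ {ξ | ∃ α : GL (Fin n) (mixedSpace K) → ℂ, IsArchTestFunction n K α ∧
      ξ = whittakerRieszVector hcpt τ hτ ℓ α} := by
  set S : Submodule ℂ E := Submodule.span ℂ {ξ | ∃ α : GL (Fin n) (mixedSpace K) → ℂ,
    IsArchTestFunction n K α ∧ ξ = whittakerRieszVector hcpt τ hτ ℓ α} with hS
  have hle : S ≤ S.comap (τ g).toLinearMap := by
    rw [hS, Submodule.span_le]
    rintro _ ⟨α, hα, rfl⟩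
    change τ g (whittakerRieszVector hcpt τ hτ ℓ α) ∈ S
    have hg : g = toArch hcpt (g : GL (Fin n) (mixedSpace K)) := Subtype.ext rfl
    rw [hg, apply_whittakerRieszVector hℓ hτu hα]
    exact Submodule.subset_span ⟨_, hα.comp_mul_right _, rfl⟩
  exact hle hv

/-- **Cyclicity of the Riesz vectors**: for `τ` irreducible unitary and `ℓ ≠ 0` a continuous
`ψ_∞`-Whittaker functional on its Gårding space, the Riesz vectors `ξ_α` (`α` a test function)
span a dense subspace of `E`: the closure of their span is a closed `τ`-stable subspace
(`apply_whittakerRieszVector` and continuity of `τ(g)`), non-zero by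
`IsArchContWhittakerFunctional.exists_whittakerRieszVector_ne_zero`, hence everything.
[cite: Shalika1974, §3] -/
theorem topologicalClosure_span_whittakerRieszVector_eq_top (hℓ : IsArchContWhittakerFunctional hcpt τ hτ ℓ)
    (hτu : τ.IsUnitary) (hτi : τ.IsTopIrreducible) (hne : ℓ ≠ 0) :
    (Submodule.span ℂ {ξ | ∃ α : GL (Fin n) (mixedSpace K) → ℂ, IsArchTestFunction n K α ∧
      ξ = whittakerRieszVector hcpt τ hτ ℓ α}).topologicalClosure = ⊤ := by
  set S : Submodule ℂ E := Submodule.span ℂ {ξ | ∃ α : GL (Fin n) (mixedSpace K) → ℂ,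
    IsArchTestFunction n K α ∧ ξ = whittakerRieszVector hcpt τ hτ ℓ α} with hS
  -- the closure is a closed subrepresentation
  let W : ContRepresentation.ClosedSubrep τ :=
    { toSubmodule := S.topologicalClosure
      apply_mem_toSubmodule := fun g v hv => by
        change v ∈ closure (S : Set E) at hv
        change τ g v ∈ closure (S : Set E)
        exact map_mem_closure (τ g).continuous hv fun w hw =>
          apply_mem_span_whittakerRieszVector hℓ hτu g hw
      isClosed' := S.isClosed_topologicalClosure }
  rcases ((ContRepresentation.isTopIrreducible_iff τ).1 hτi).2 W with h | h
  · -- impossible: some `ξ_α ≠ 0` lies in `W`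
    exfalso
    obtain ⟨α, hα, hξ⟩ := hℓ.exists_whittakerRieszVector_ne_zero hτu hne
    have hmem : whittakerRieszVector hcpt τ hτ ℓ α ∈ W :=
      S.le_topologicalClosure (Submodule.subset_span ⟨α, hα, rfl⟩)
    rw [h, ContRepresentation.ClosedSubrep.mem_bot] at hmem
    exact hξ hmem
  · have := congrArg (fun W : ContRepresentation.ClosedSubrep τ => W.toSubmodule) h
    simpa only [W, ContRepresentation.ClosedSubrep.toSubmodule_top] using this

end Covariance

end Literature.NumberTheory.Automorphic
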